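import Summits.BirchSwinnertonDyer.BirchSwinnertonDyer.Theorems.ManinLocalTwoThreeDyadicUntwistTransport
import Summits.BirchSwinnertonDyer.BirchSwinnertonDyer.Theses.ManinLocalTwoThree
import Literature.NumberTheory.EllipticCurves.OggFormulaPotGoodOrdinaryTwoProofs
import Literature.NumberTheory.EllipticCurves.IsogenyConductorModularityProofs
import Literature.NumberTheory.EllipticCurves.ManinConstantSemistablePrimewise
import Literature.NumberTheory.DiophantineGeometry.ConductorRingOfIntegersProofs
import Literature.NumberTheory.DiophantineGeometry.ConductorAdditiveProofs
import HarnessLib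

/-!
# C2 `ManinOddAtFour` HOLDS on the stratum `ord₂ j ≤ 0` — every potentially multiplicative and every potentially good ORDINARY curve
# with `4 ∣ N` has odd Manin constant, GIVEN the crux's own four printed-fact binders (route `ManinLocalTwoThree`, crux C2
# stmt-BirchSwinnertonDyer-22967; cell bsd-f2-manin, p2 gen 14)

For `W/ℚ` elliptic and additive at `2` with `|j(W)|₂ = 2^ν ≥ 1` the tree's Tate-form trichotomy (`QuadraticTwistTateFormTwoProofs`,
`OggFormulaPotGoodOrdinaryTwoProofs`) writes `W ≅ T^{(d₀)}` over `ℚ` with `T = tateFormOfJ j(W)` and `4 ∤ d₀`, and additivity excludes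
`d₀ ≡ 1 (mod 4)`; so `d₀ = u·d` with `u ≡ 1 (mod 4)` and `d ∈ {−1, 2, −2}`, i.e. `W ≅ (T^{(u)}) ⊗ ℚ(√d)` with `T^{(u)}` SEMISTABLE at `2`
(`not_hasAdditiveReductionAt_of_emod_four_eq_one_of_valuation_j_eq_exp`).  On a globally minimal model `W'` of `T^{(u)}` every lattice-optimal
datum has odd Manin constant by the printed semistable-prime theorem (`cesnavicius2018_not_dvd_maninConstant_of_not_sq_dvd_level`: `4 ∤ N(W')`,
with Carayol's `N = N(W')` and isogeny invariance of `N` from modularity), and this seat's dyadic untwist transport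
(`maninLocalTwoThree_not_dvd_maninConstant_of_dyadicUntwist_semistable`, Stevens `η = 1` AND `η = 2`) carries `2 ∤ c` up to every lattice-optimal
datum of `W`.  RESULT (`maninOddAtFour_of_one_le_valuation_j`): the body of `ManinOddAtFour` for every `W` with `ord₂ j(W) ≤ 0` — the Kodaira rows
`I₄*/12`, `Iₙ≥5*/(n+8)` (`f₂ = 4`) and `II?`-free rows `I₈*/18`, `Iₙ≥9*/(n+10)` (`f₂ = 6`) —, so that C2 is REDUCED BY NAME to the potentially
supersingular curves, `ord₂ j > 0` (`maninOddAtFour_of_pos_ordJ`).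
HONEST FRAMING: a by-name partial discharge of the crux on an explicit `j`-stratum, modulo exactly the crux's printed-fact binders
(Mazur 1978, Abbes–Ullmo 1996, Česnavičius 2018, modularity); assembled from printed lemmas (Stevens 1989 (5.2)/(5.4), Pal 2012, Silverman
*ATAEC* IV.9.4 / V.5), printed nowhere as such.  Nothing about BSD is proved; Manin's conjecture at `2` stays OPEN on `ord₂ j > 0`; C2 OPEN.
[cite: Stevens1989, Lemmas (5.2), (5.4) pp. 96–97] [cite: Cesnavicius2018, Thm. 1.2] [cite: SilvermanAEC2009, X.5 Cor. 5.4.1]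
[cite: SilvermanATAEC1994, V.5 Lemma 5.1 and IV.11.1]
-/

set_option autoImplicit false
-- lint-debt: the directory name repeats the summit name (sibling precedent `ManinLocalTwoThreeDyadicUntwistTransport.lean`)
set_option linter.dupNamespace false

noncomputable section

open scoped Classical NumberField
open WeierstrassCurve IsDedekindDomain IsDedekindDomain.HeightOneSpectrum Rat.HeightOneSpectrum
  Literature.NumberTheory.DiophantineGeometry Literature.NumberTheory.EllipticCurves
  Literature.NumberTheory.EllipticCurves.ModularForms

namespace Summit.BirchSwinnertonDyer.BirchSwinnertonDyer.Theorems.ManinLocalTwoThree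

/-! ## §1 `ord₂ j ≤ 0` and additive at `2`: `W` is a `χ_d`-twist, `d ∈ {−1, 2, −2}`, of a curve semistable at `2` -/

section Place

variable (v : HeightOneSpectrum (𝓞 ℚ))

/-- **An additive curve at `2` with `|j|₂ = 2^ν` (`ν ≥ 0`) is a dyadic twist of a `2`-semistable curve**: there are `u ≡ 1 (mod 4)`,
`d ∈ {−1, 2, −2}` and `C` with `C • W = ((tateFormOfJ j(W)) ⊗ u) ⊗ d`, and `(tateFormOfJ j(W)) ⊗ u` is not additive at `2`.
[cite: SilvermanAEC2009, X.5 Cor. 5.4.1] [cite: SilvermanATAEC1994, V.5 Lemma 5.1] -/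
theorem exists_eq_dyadicTwist_of_semistable_of_valuation_j_eq_exp_of_hasAdditiveReductionAt
    (hv : natGenerator v = 2) (W : WeierstrassCurve ℚ) [W.IsElliptic] {ν : ℕ}
    (hν : v.valuation ℚ W.j = WithZero.exp (ν : ℤ)) (hadd : W.HasAdditiveReductionAt v) :
    ∃ (u d : ℤ) (C : VariableChange ℚ), u % 4 = 1 ∧ (d = -1 ∨ d = 2 ∨ d = -2) ∧
      C • W = ((tateFormOfJ W.j).quadraticTwist (u : ℚ)).quadraticTwist (d : ℚ) ∧
      ((tateFormOfJ W.j).quadraticTwist (u : ℚ)).conductorExponent v ≤ 1 := by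
  obtain ⟨hj0, hj1728, -⟩ := W.j_ne_and_valuation_j_sub_eq_of_valuation_j_eq_exp v hv hν
  haveI := isElliptic_tateFormOfJ hj0 hj1728
  obtain ⟨d₀, hd₀0, hd₀4, C, hC⟩ := W.exists_int_variableChange_eq_quadraticTwist_tateFormOfJ hj0 hj1728
  -- `d₀ = u · d` with `u ≡ 1 (mod 4)`, `d ∈ {−1, 2, −2}` (additivity excludes `d₀ ≡ 1 (mod 4)`)
  obtain ⟨u, d, hu, hd, hud⟩ : ∃ u d : ℤ, u % 4 = 1 ∧ (d = -1 ∨ d = 2 ∨ d = -2) ∧ d₀ = u * d := by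
    rcases (show d₀ % 4 = 1 ∨ d₀ % 4 = 2 ∨ d₀ % 4 = 3 by omega) with h | h | h
    · exact absurd hadd (W.not_hasAdditiveReductionAt_of_emod_four_eq_one_of_valuation_j_eq_exp v hv hν h hC)
    · obtain ⟨e, he⟩ : ∃ e : ℤ, d₀ = 2 * e := ⟨d₀ / 2, by omega⟩
      rcases (show e % 4 = 1 ∨ e % 4 = 3 by omega) with he' | he'
      · exact ⟨e, 2, he', Or.inr (Or.inl rfl), by rw [he]; ring⟩
      · exact ⟨-e, -2, by omega, Or.inr (Or.inr rfl), by rw [he]; ring⟩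
    · exact ⟨-d₀, -1, by omega, Or.inl rfl, by ring⟩
  have hu0 : ((u : ℤ) : ℚ) ≠ 0 := by exact_mod_cast (show u ≠ 0 by omega)
  haveI := (tateFormOfJ W.j).isElliptic_quadraticTwist hu0
  refine ⟨u, d, C, hu, hd, ?_, ?_⟩
  · rw [hC, WeierstrassCurve.quadraticTwist_quadraticTwist, hud]; push_cast; rfl
  · -- `T ⊗ u` has the same `j` and is `T^{(u)}` with `u ≡ 1 (mod 4)`: not additive, `f_v ≤ 1`
    have hjT : ((tateFormOfJ W.j).quadraticTwist (u : ℚ)).j = W.j := by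
      rw [(tateFormOfJ W.j).j_quadraticTwist hu0]; exact tateFormOfJ_j hj0 hj1728
    have hν' : v.valuation ℚ ((tateFormOfJ W.j).quadraticTwist (u : ℚ)).j = WithZero.exp (ν : ℤ) := by rw [hjT]; exact hν
    have hC' : (1 : VariableChange ℚ) • (tateFormOfJ W.j).quadraticTwist (u : ℚ) =
        (tateFormOfJ ((tateFormOfJ W.j).quadraticTwist (u : ℚ)).j).quadraticTwist (u : ℚ) := by
      rw [one_smul, hjT]
    have hna := ((tateFormOfJ W.j).quadraticTwist (u : ℚ)).not_hasAdditiveReductionAt_of_emod_four_eq_one_of_valuation_j_eq_exp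
      v hv hν' hu hC'
    by_contra h
    exact hna ((WeierstrassCurve.two_le_conductorExponent_iff_holds v _).mp (by omega))

end Place

/-! ## §2 C2 on the stratum `ord₂ j ≤ 0` -/

/-- **`ManinOddAtFour` on `ord₂ j ≤ 0`** (`|j|₂ = 2^ν`, `ν ≥ 0`, at the place `v ∋ 2` of `𝓞 ℚ`): granted the four printed facts of the crux
(Mazur 1978 Cor. 4.1, Abbes–Ullmo 1996 Thm. A, Česnavičius 2018 Thm. 1.2, the Modularity Theorem), every lattice-optimal `X₀(N)`-datum of a
globally minimal `W/ℚ` with `4 ∣ N` and `ord₂ j(W) ≤ 0` has ODD Manin constant.  Proof: §1 writes `W ∼ W' ⊗ ℚ(√d)` with `W'` globally minimal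
and semistable at `2` (`4 ∤ N(W')`), `d ∈ {−1, 2, −2}`; `2 ∤ c` on the class of `W'` is the printed semistable-prime theorem
(`cesnavicius2018_not_dvd_maninConstant_of_not_sq_dvd_level` with Carayol `N₁ = N(W₁) = N(W')`); the dyadic untwist transport
`maninLocalTwoThree_not_dvd_maninConstant_of_dyadicUntwist_semistable` (Stevens `η = 1` and `η = 2`) finishes.
[cite: Stevens1989, Lemmas (5.2), (5.4)] [cite: Cesnavicius2018, Thm. 1.2] [cite: Mazur1978, Cor. 4.1] [cite: AbbesUllmo1996, Thm. A]
[cite: SilvermanAEC2009, X.5 Cor. 5.4.1] -/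
theorem not_two_dvd_maninConstant_of_valuation_j_eq_exp
    (hM : mazur_not_dvd_maninConstant_of_odd) (hAU : abbesUllmo_not_dvd_maninConstant_of_not_dvd_level)
    (hC2 : cesnavicius_not_two_dvd_maninConstant_of_two_dvd_level) (hnf : exists_isNewformOf)
    {v : HeightOneSpectrum (𝓞 ℚ)} (hv : natGenerator v = 2)
    {W : WeierstrassCurve ℚ} [W.IsElliptic] [W.IsGloballyMinimal] {N : ℕ} [NeZero N] (D : ModularParametrizationData W N)
    (hopt : ∀ z ∈ D.L.lattice, ∃ w ∈ periodLattice D.f, z = D.c * w) (h4 : 2 ^ 2 ∣ N) {ν : ℕ}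
    (hν : v.valuation ℚ W.j = WithZero.exp (ν : ℤ)) : ¬ (2 : ℤ) ∣ D.maninConstant := by
  haveI : Fact (Nat.Prime 2) := ⟨Nat.prime_two⟩
  have hmod : nonempty_modularParametrizationData := maninLocalTwoThree_nonempty_modularParametrizationData_of_exists_isNewformOf hnf
  -- the place of `ℤ` below `v` and the factorisation of conductors at `2`
  set vZ : HeightOneSpectrum ℤ := (primesEquiv (R := ℤ)).symm ⟨2, Nat.prime_two⟩ with hvZdef
  have hvZ : natGenerator vZ = 2 := congrArg Subtype.val ((primesEquiv (R := ℤ)).apply_symm_apply ⟨2, Nat.prime_two⟩)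
  have hvv : primesEquiv vZ = primesEquiv v := by
    apply Subtype.ext
    change natGenerator vZ = natGenerator v
    rw [hvZ, hv]
  have hfac : ∀ (V : WeierstrassCurve ℚ) [V.IsElliptic], (V.conductorNorm ℤ).factorization 2 = V.conductorExponent v := by
    intro V _
    rw [← hvZ, V.factorization_conductorNorm_holds vZ, WeierstrassCurve.conductorExponent_eq_of_primesEquiv_eq vZ v V hvv]
  -- `W` is additive at `2`
  have hN : N = W.conductorNorm ℤ := IsNewformOf.level_eq_conductorNorm_of_exists_isNewformOf hnf D.isNewformOf
  have hadd : W.HasAdditiveReductionAt v := by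
    refine (WeierstrassCurve.two_le_conductorExponent_iff_holds v W).mp ?_
    rw [← hfac W]
    exact (Nat.prime_two.pow_dvd_iff_le_factorization (W.conductorNorm_pos_holds).ne').mp (hN ▸ h4)
  -- §1: `C • W = (T ⊗ u) ⊗ d`
  obtain ⟨hj0, hj1728, -⟩ := W.j_ne_and_valuation_j_sub_eq_of_valuation_j_eq_exp v hv hν
  haveI := isElliptic_tateFormOfJ hj0 hj1728
  obtain ⟨u, d, C, hu, hd, hC, hfu⟩ :=
    exists_eq_dyadicTwist_of_semistable_of_valuation_j_eq_exp_of_hasAdditiveReductionAt v hv W hν hadd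
  have hu0 : ((u : ℤ) : ℚ) ≠ 0 := by exact_mod_cast (show u ≠ 0 by omega)
  have hd0 : ((d : ℤ) : ℚ) ≠ 0 := by exact_mod_cast (show d ≠ 0 by omega)
  set T := tateFormOfJ W.j with hT
  haveI := T.isElliptic_quadraticTwist hu0
  -- a globally minimal model `W'` of `T ⊗ u`: semistable at `2`
  obtain ⟨C₁, hC₁⟩ := hasGlobalMinimalModel_rat_holds (T.quadraticTwist (u : ℚ))
  haveI := hC₁
  set W' : WeierstrassCurve ℚ := C₁ • T.quadraticTwist (u : ℚ) with hW'
  have hf' : W'.conductorExponent v ≤ 1 := by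
    rw [hW', conductorExponent_smul']; exact hfu
  have h4N' : ¬ 2 ^ 2 ∣ W'.conductorNorm ℤ := fun h ↦ by
    have := (Nat.prime_two.pow_dvd_iff_le_factorization (W'.conductorNorm_pos_holds).ne').mp h
    rw [hfac W'] at this
    omega
  -- `W ∼ W' ⊗ d`
  haveI := W'.isElliptic_quadraticTwist hd0
  have hWW' : W'.quadraticTwist (d : ℚ) = ((⟨C₁.u, (d : ℚ) * C₁.r, 0, 0⟩ : VariableChange ℚ) * C) • W := by
    rw [mul_smul, hC, hW', WeierstrassCurve.quadraticTwist_smul]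
  have htw : IsIsogenous W (W'.quadraticTwist (d : ℚ)) := by rw [hWW']; exact isIsogenous_smul W _
  -- `2 ∤ c` on the class of `W'` (printed, `4 ∤ N`)
  have hp : ∀ (W₁ : WeierstrassCurve ℚ) [W₁.IsElliptic] [W₁.IsGloballyMinimal] {N₁ : ℕ} [NeZero N₁]
      (D₁ : ModularParametrizationData W₁ N₁), IsIsogenous W' W₁ →
      (∀ z ∈ D₁.L.lattice, ∃ w ∈ periodLattice D₁.f, z = D₁.c * w) → ¬ (2 : ℤ) ∣ D₁.maninConstant := by
    intro W₁ _ _ N₁ _ D₁ hiso hopt₁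
    have hN₁ : N₁ = W₁.conductorNorm ℤ := IsNewformOf.level_eq_conductorNorm_of_exists_isNewformOf hnf D₁.isNewformOf
    have hNN : W'.conductorNorm ℤ = W₁.conductorNorm ℤ := conductorNorm_eq_of_isIsogenous_of_modularity_of_isGloballyMinimal hmod hiso
    have h4N₁ : ¬ 2 ^ 2 ∣ N₁ := by rw [hN₁, ← hNN]; exact h4N'
    exact_mod_cast cesnavicius2018_not_dvd_maninConstant_of_not_sq_dvd_level hM hAU hC2 W₁ D₁ hopt₁ Nat.prime_two h4N₁
  exact maninLocalTwoThree_not_dvd_maninConstant_of_dyadicUntwist_semistable hnf D hopt h4 hd htw h4N' hp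

/-- **C2 `ManinOddAtFour` RESTRICTED to `ord₂ j ≤ 0`, in the crux's own binder shape** (`1 ≤ |j|_v` at the place `v₂` of `𝓞 ℚ` above `2`): the
four printed facts imply that every lattice-optimal `X₀(N)`-datum of a globally minimal `W` with `4 ∣ N` and `ord₂ j(W) ≤ 0` has odd Manin
constant.  So the OPEN content of C2 is the potentially supersingular case `ord₂ j > 0`.
[cite: Stevens1989, Lemmas (5.2), (5.4)] [cite: Cesnavicius2018, Thm. 1.2] [cite: SilvermanAEC2009, X.5 Cor. 5.4.1] -/
theorem maninOddAtFour_of_one_le_valuation_j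
    (hM : mazur_not_dvd_maninConstant_of_odd) (hAU : abbesUllmo_not_dvd_maninConstant_of_not_dvd_level)
    (hC2 : cesnavicius_not_two_dvd_maninConstant_of_two_dvd_level) (hnf : exists_isNewformOf)
    (W : WeierstrassCurve ℚ) [W.IsElliptic] [W.IsGloballyMinimal] {N : ℕ} [NeZero N] (D : ModularParametrizationData W N)
    (hopt : ∀ z ∈ D.L.lattice, ∃ w ∈ periodLattice D.f, z = D.c * w) (h4 : 2 ^ 2 ∣ N)
    (hj : 1 ≤ ((primesEquiv (R := 𝓞 ℚ)).symm ⟨2, Nat.prime_two⟩).valuation ℚ W.j) : ¬ (2 : ℤ) ∣ D.maninConstant := by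
  set v : HeightOneSpectrum (𝓞 ℚ) := (primesEquiv (R := 𝓞 ℚ)).symm ⟨2, Nat.prime_two⟩ with hvdef
  have hv : natGenerator v = 2 := congrArg Subtype.val ((primesEquiv (R := 𝓞 ℚ)).apply_symm_apply ⟨2, Nat.prime_two⟩)
  rcases hj.eq_or_lt with h | h
  · exact not_two_dvd_maninConstant_of_valuation_j_eq_exp hM hAU hC2 hnf hv D hopt h4 (W.valuation_j_eq_exp_zero_of_eq_one v h.symm)
  · obtain ⟨ν, -, hν⟩ := W.exists_valuation_j_eq_exp v h
    exact not_two_dvd_maninConstant_of_valuation_j_eq_exp hM hAU hC2 hnf hv D hopt h4 hν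

/-- **C2 REDUCED BY NAME to the potentially supersingular curves**: the route decl `ManinOddAtFour` follows from its restriction to the globally
minimal `W` with `ord₂ j(W) > 0` (`|j|_{v₂} < 1`). [cite: Stevens1989, Lemmas (5.2), (5.4)] [cite: Cesnavicius2018, Thm. 1.2] -/
theorem maninOddAtFour_of_pos_ordJ
    (hss : mazur_not_dvd_maninConstant_of_odd → abbesUllmo_not_dvd_maninConstant_of_not_dvd_level →
      cesnavicius_not_two_dvd_maninConstant_of_two_dvd_level → exists_isNewformOf →
      ∀ (W : WeierstrassCurve ℚ) [W.IsElliptic] [W.IsGloballyMinimal] {N : ℕ} [NeZero N] (D : ModularParametrizationData W N),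
        (∀ z ∈ D.L.lattice, ∃ w ∈ periodLattice D.f, z = D.c * w) → 2 ^ 2 ∣ N →
        ((primesEquiv (R := 𝓞 ℚ)).symm ⟨2, Nat.prime_two⟩).valuation ℚ W.j < 1 → ¬ (2 : ℤ) ∣ D.maninConstant) :
    Summit.BirchSwinnertonDyer.BirchSwinnertonDyer.Theses.ManinLocalTwoThree.ManinOddAtFour := by
  intro hM hAU hC2 hnf W _ _ N _ D hopt h4
  by_cases hj : 1 ≤ ((primesEquiv (R := 𝓞 ℚ)).symm ⟨2, Nat.prime_two⟩).valuation ℚ W.j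
  · exact maninOddAtFour_of_one_le_valuation_j hM hAU hC2 hnf W D hopt h4 hj
  · exact hss hM hAU hC2 hnf W D hopt h4 (not_le.mp hj)

end Summit.BirchSwinnertonDyer.BirchSwinnertonDyer.Theorems.ManinLocalTwoThree

end
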